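import Literature.MathematicalPhysics.QuantumFieldTheory.Balaban1983to89.B9PerturbationMajorantsAtLetters
import Literature.MathematicalPhysics.QuantumFieldTheory.Balaban1983to89.B9Delta2FormMajorant
import Literature.MathematicalPhysics.QuantumFieldTheory.Balaban1983to89.B9Letters313AtOneDv
import Literature.MathematicalPhysics.QuantumFieldTheory.Balaban1983to89.B9QstarLettersAtPins

/-!
# `Balaban1983to89.B9Eq3117CurrentMajFromLetter` — T. Bałaban, *Propagators for lattice gauge theories in a background field*, Commun. Math. Phys. **99**
# (1985) 389–434 [`Balaban1985BackgroundPropagators`, "B9"] (3.117) p. 419 with (3.36) p. 396: THE CURRENT LETTERS `B = Δ(U)∘D_U`, `B† = D*_U∘Δ(U)` OF THE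
# N06 CERTIFICATE (`CurrentMaj` at node00-def-Y's coordinate models `BcoKH ∕ BdcoKH`, binder `hBJ`) FROM A NORM-LOCAL FORM OF THE IDENTITY (3.117) AND A
# PER-BOND SIZE OF THE CURRENT `J` — the [4]-(2.51) majorant bookkeeping for two RANGE-ONE operators

[4] = T. Bałaban, *Propagators and renormalization transformations for lattice gauge theories. II*, Commun. Math. Phys. **96** (1984) 223–250
[`Balaban1984PropagatorsII`].

statement-level skeleton of published theorems with citation tags; proofs where landed; nothing here is a claim about the Yang–Mills mass gap

THE PRINT.  p. 419, (3.117): *«⟨A − Dλ, Δ(A − Dλ)⟩ = ⟨A, ΔA⟩ − ⟨i[λ(b₋), A(b)] − i[A(b), R_bλ(b₊)] − i[λ(b₋),(Dλ)(b)], J⟩ … almost invariance of the quadratic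
form, the error terms are small because the function J = D*η⁻²Im ∂U is small, if U satisfies the condition (3.36)»*; read as an operator identity (the
pub-balaban NE9 chain's `B9Eq3117HessOpGaugeMode.equiv_hessOp_covDerivL2K` on ITS carrier): `(Δ(U)D_Uλ)(b) = (i∕2)[J(b), λ(b₋) + R(U_b)λ(b₊)]` — ORDER ZERO in
`λ`, NO `η⁻¹`, a ONE-STEP stencil; its transpose `(D*_UΔ(U)A)(x)` reads `A` on the `2(d+1)` bonds at `x`, with the same coefficients.  p. 396, (3.36) ⟹
`|J(b)| ≤ O(1)Mα₀(Lʲη)⁻³` (r06 `B9Eq336CurrentBound.norm_J_le_blocks`, at node00-def-Y's letters `B9Delta2FormMajorant.norm_JY_le_of_regularAt`; at print's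
cube class for EVERY bond `B9Eq336RegularAtAllBondsP`).  [4] (2.51) p. 232: the block majorants `|(Tλ)(x)| ≤ K(y, y′)|λ|`.

WHY THIS FILE (cell `pub-ymgap`, node N06; width seat `pub-ymgap-dag-n06-w8` (g4), CLAIM-12 2026-08-28).  The stage-11 certificate of dag-n06-d (editions ≥ 23,
`…N06AtOpsYNuOfRecordV6EPairNS` :158) DISPLAYS the current letters as the schema `hBJ : … → CurrentMaj (𝔬12 x).blkW (𝔬12 x).blk (BcoKH … U) (BdcoKH … U) 1 (H x)
(t_J·(M_xα₀)) δ_B` (dag-n06-l `B9PerturbationMajorantAlgebra.CurrentMaj`: «at def-Y's letters its derivation is the (3.117) carrier bridge, not typed here»).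
That bridge has two halves: (i) the identity (3.117) at def-Y's `hessGradY U = hessY U ∘ gradY U` ∕ `divHessY U = divY U ∘ hessY U` (node00-def-Y's road,
stone 1 = `Node00/OpsYCurlGrad`); (ii) the passage from a one-step stencil with coefficients `|J|` to the [4]-(2.51) majorant `t_B·(Lʲη)⁻³·e^{−δ_B d}` between
the certificate's block maps.  THIS FILE types (ii) against a DISPLAYED NORM-LOCAL FORM of (i):
* §1 the DISPLAYED hypotheses of printed shape `‖(Δ(U)D_Uλ)(f)‖ ≤ k₃·‖J(U)(f)‖·(‖λ(f₋)‖ + ‖λ(f₊)‖)` (`hg`) and its transpose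
  `‖(D*_UΔ(U)A)(x)‖ ≤ k₃·Σ_μ (‖J⟨x, μ⟩‖·‖A⟨x, μ⟩‖ + ‖J⟨x − e_μ, μ⟩‖·‖A⟨x − e_μ, μ⟩‖)` (`dh`) about def-Y's genuine `hessGradY ∕ divHessY ∕ JY` (`k₃ = 1` when the
  conventions of `hessY` match print's (3.10) exactly; displayed free) — no `Prop` is defined, the two clauses are binders of the theorems of §3–§4;
  `hg_one ∕ dh_one` — their `U = 1` inhabitants (`hessGradY_one`, `divHessY_one`, `JY_one`; non-vacuity).
* §2 the geometry of a range-one stencil under the certificate's pins `hβ1` (1-faithful `bI`) ∕ `hbI0` (direction-blind `bI`): `dist_bI_tgt_le_three`,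
  `dist_bI_unshift_le_three` (the blocks of the two ends of a fine bond are at `geo9K`-distance ≤ 3), `lvl_window_of_dist_le_three` (a one-level window, [4]
  (2.2) in walk form `levelGapT`), `inv_len_cube_le_of_dist_le_three` (`(Lʲη)⁻³` moves across it at the price `L³`).
* §3 `BcoKH_apply ∕ BdcoKH_apply`, ★ `abs_BcoKH_apply_le ∕ abs_BdcoKH_apply_le` — the pointwise bounds of the two models under the letter (the reading constant
  `(cR39 b)⁻¹·coordBound·basisBound` of dag-n06-d's coordinate functor displayed).
* §4 ★★ `hasMajorantHom_BcoKH_of_letter` ∕ ★★ `hasMajorantHom_BdcoKH_of_letter` — from `hg` ∕ `hdh` at `cfg U₁` and a per-bond current size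
  `hJ : ‖J(U₁)(f)‖ ≤ C_J·((geo9K i).len (bI f)³)⁻¹`: the models are majorised between the certificate's carriers (`blkSK (sIK bI)` on sites, `blkBK bI` on bonds)
  by `t_B·((geo9K i).len a³)⁻¹·e^{−δd(a, a′)}` for EVERY `δ ≥ 0` and every `t_B ≥ 2(d+1)·L³·k₃·C_J·e^{3δ}` (the reading constant collapses: dag-n06-w5's
  `B9QstarLettersAtPins.reading_const_collapse` BY NAME); ★★ `currentMaj_of_letter` — the pair IS `CurrentMaj`.  The member ∕ pins forms (binder `hBJ` verbatim, `hJ` from the certificate's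
  `hreg` or from (3.36) at print's class) are the sequel `Summits/…/BalabanUVNodesN06CurrentMajAtPinsPhys`.
HONEST SCOPE.  Finite-dimensional bookkeeping ([4] (2.51) for two one-step stencils) over node00-def-Y's ∕ dag-n06-d's ∕ dag-n06-l's landed definitions; (3.117)
itself stays a DISPLAYED hypothesis (`hg ∕ hdh`) until the (3.117) road at def-Y's letters lands; nothing of [B9]'s estimates is asserted; one
finite lattice at a time; count-neutral; N06 NOT discharged; nothing continuum ∕ OS ∕ mass gap ∕ Clay.  NEW file; declares nothing in `Node00.*`; nothing landed
is modified.  0 `def`; net new unproved facts: 0.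
-/

noncomputable section

namespace Literature.MathematicalPhysics.QuantumFieldTheory.Balaban1983to89.B9Eq3117CurrentMajFromLetter

open B6Geom246MultiLevelTorus (geomT bondT levelGapT connectedT)
open B6GlobalChartV1 (PV blkV1 boxEquiv)
open B6KLevelCensusIndexV1 (KIdx kGeo)
open B6Ineq2142KLevelV1 (β lvl beta_level)
open B6RandomWalk (BlockSupp)
open B6RandomWalkHom (HasMajorantHom hasMajorantHom_mono)
open B6Ineq288MultiLevelTorus (dist_symm_geoBT)
open B10StarCount (shift_unshift unshift_shift)
open B9GeoNormsKLevelV1 (geo9K)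
open B9GeoLemma21KLevelV1 (geo9K_len_pos geo9K_dist_comm geo9K_dist_self geo9K_one_le_L)
open B9Ineq349SiteComposite (distB distB_nonneg)
open B9Ineq349SiteFromBlocks (distB_triangle)
open B9Thm39ReadingCoords (cR39 cR39_nonneg coordBound39 basisBound39 abs_repr_le norm_sum_smul_basis_le)
open B9Thm34Ext (toB6)
open B9CoReadingCoords (assembleK XBK blkBK)
open B9CoReadingCoordsH (coordOpKH_apply)
open B9CoReadingCoordsS (XSK blkSK sIK)
open B9PerturbationSplitAtLetters (hessGradY divHessY hessGradY_one divHessY_one)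
open B9PerturbationMajorantsAtLetters (BcoKH BdcoKH)
open B9PerturbationMajorantAlgebra (CurrentMaj)
open B9Letters313AtOneDv (distB_blkV1_shift_le_one)
open B9QstarLettersAtPins (reading_const_collapse)
open Node00 (SiteY FBondY IBondY CfgY JY JY_one)

variable {d ℓ : ℕ} {hd : 1 ≤ d + 1} {hL : Odd (ℓ + 1) ∧ 1 < ℓ + 1} {b₀ b₁ : ℝ}

/-! ## §1 The norm-local form of (3.117) and of its transpose, as a hypothesis schema about def-Y's letters -/

section Letter

variable {𝔸 : Type} [NormedRing 𝔸] [NormedAlgebra ℂ 𝔸] [CompleteSpace 𝔸]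
variable (i : KIdx d ℓ hd hL b₀ b₁)

/-- **(3.117) IN NORM-LOCAL FORM AT node00-def-Y's LETTERS — THE `U = 1` INHABITANT OF THE FIRST CLAUSE** (non-vacuity of the displayed hypothesis
`hg : ∀ Λ f, ‖(Δ(U)D_Uλ)(f)‖ ≤ k₃·‖J(U)(f)‖·(‖λ(f₋)‖ + ‖λ(f₊)‖)` of §3–§4): at the trivial background `B(1) = Δ(1)∘D_1 = 0` (dag-n06-l `hessGradY_one`) and
`J(1) = 0` (def-Y `JY_one`), so the clause holds for every `k₃`.  (Print: `(ΔD_Uλ)(b) = (i∕2)[J(b), λ(b₋) + R(U_b)λ(b₊)]`, an order-zero one-step stencil — the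
clause with `k₃ = 1` at `G ⊂ U(N)`-valued `U` once def-Y's `hessY` is identified with print's (3.10); here a HYPOTHESIS of printed shape, nothing asserted.)
[cite: Balaban1985BackgroundPropagators, (3.117) p.419, (3.10)–(3.11) p.392, (3.3) p.390, Cor. 3.5 p.407 («for U = 1 …»)] -/
theorem hg_one (k₃ : ℝ) (Λ : SiteY i → 𝔸) (f : FBondY i) :
    ‖hessGradY i (fun _ _ => (1 : 𝔸ˣ)) Λ f‖ ≤
      k₃ * ‖JY i (fun _ _ => (1 : 𝔸ˣ)) f‖ * (‖Λ (boxEquiv i.hN f.src)‖ + ‖Λ (boxEquiv i.hN f.tgt)‖) := by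
  have h0 : hessGradY i (fun _ _ => (1 : 𝔸ˣ)) Λ f = 0 := by rw [hessGradY_one]; rfl
  rw [h0, norm_zero, JY_one, norm_zero, mul_zero, zero_mul]

/-- **THE `U = 1` INHABITANT OF THE TRANSPOSED CLAUSE** `hdh : ∀ A x, ‖(D*_UΔ(U)A)(x)‖ ≤ k₃·Σ_μ (‖J⟨x,μ⟩‖·‖A⟨x,μ⟩‖ + ‖J⟨x−e_μ,μ⟩‖·‖A⟨x−e_μ,μ⟩‖)`: `B†(1) =
D*_1∘Δ(1) = 0` (`divHessY_one`), `J(1) = 0`. [cite: Balaban1985BackgroundPropagators, (3.117) p.419, p.421, (3.8) p.392, Cor. 3.5 p.407] -/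
theorem dh_one (k₃ : ℝ) (A : FBondY i → 𝔸) (s : Site (PV d ℓ i.m i.K hd hL) 0) :
    ‖divHessY i (fun _ _ => (1 : 𝔸ˣ)) A (boxEquiv i.hN s)‖ ≤
      k₃ * ∑ μ : Fin (d + 1), (‖JY i (fun _ _ => (1 : 𝔸ˣ)) ⟨s, μ⟩‖ * ‖A ⟨s, μ⟩‖ +
        ‖JY i (fun _ _ => (1 : 𝔸ˣ)) ⟨s.unshift μ, μ⟩‖ * ‖A ⟨s.unshift μ, μ⟩‖) := by
  have h0 : divHessY i (fun _ _ => (1 : 𝔸ˣ)) A (boxEquiv i.hN s) = 0 := by rw [divHessY_one]; rfl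
  rw [h0, norm_zero]
  simp only [JY_one, norm_zero, zero_mul, add_zero, Finset.sum_const_zero, mul_zero, le_refl]

end Letter

/-! ## §2 The geometry of a one-step stencil under the certificate's pins: distance ≤ 3, a one-level window, `(Lʲη)⁻³` across it -/

section Geometry

variable (i : KIdx d ℓ hd hL b₀ b₁) {bI : FBondY i → IBondY i}

/-- the site block map induced by `bI` reads a charted torus site through the fine bond `⟨s, e₀⟩`. [cite: Balaban1984PropagatorsII, (2.45) p.231, dictionary] -/
theorem sIK_boxEquiv (s : Site (PV d ℓ i.m i.K hd hL) 0) : sIK i bI (boxEquiv i.hN s) = bI ⟨s, 0⟩ := by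
  rw [sIK, Equiv.symm_apply_apply]

/-- under a direction-blind `bI` (the certificate's pin `hbI0`) the source site of a fine bond sits in the bond's own block: `sIK bI (f₋) = bI f`.
[cite: Balaban1984PropagatorsII, (2.45) p.231, dictionary] -/
theorem sIK_boxEquiv_src (hbI0 : ∀ f : FBondY i, bI f = bI ⟨f.src, 0⟩) (f : FBondY i) : sIK i bI (boxEquiv i.hN f.src) = bI f := by
  rw [sIK_boxEquiv, ← hbI0]

/-- **THE TWO ENDS OF A FINE BOND ARE RE-BLOCKED AT DISTANCE ≤ 3**: `d(bI f, bI⟨f₊, e₀⟩) ≤ 3` for a 1-faithful `bI` (pin `hβ1`): carrier block → torus block of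
`f` (≤ 1) → torus block of the translate (≤ 1, dag-n06-w3 `distB_blkV1_shift_le_one`) → carrier block (≤ 1).
[cite: Balaban1984PropagatorsII, (2.45)–(2.46) p.231, (2.54) p.233; Balaban1985BackgroundPropagators, (3.117) p.419 (one-step stencil)] -/
theorem dist_bI_tgt_le_three (hβ1 : ∀ f : FBondY i, (geomT i.D).dist (β i.hN i.D i.hk (bI f)) (blkV1 i.hN i.D f) ≤ 1) (f : FBondY i) :
    (geo9K i).dist (bI f) (bI ⟨f.tgt, 0⟩) ≤ 3 := by
  change distB i (β i.hN i.D i.hk (bI f)) (β i.hN i.D i.hk (bI ⟨f.tgt, 0⟩)) ≤ 3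
  have h1 : distB i (β i.hN i.D i.hk (bI f)) (blkV1 i.hN i.D f) ≤ 1 := hβ1 f
  have h2 : distB i (blkV1 i.hN i.D (⟨f.src.shift f.dir, 0⟩ : FBondY i)) (blkV1 i.hN i.D (⟨f.src, f.dir⟩ : FBondY i)) ≤ 1 :=
    distB_blkV1_shift_le_one i f.src f.dir 0 f.dir
  have h2' : distB i (blkV1 i.hN i.D f) (blkV1 i.hN i.D (⟨f.tgt, 0⟩ : FBondY i)) ≤ 1 := by
    rw [distB, dist_symm_geoBT]; exact h2
  have h3 : distB i (blkV1 i.hN i.D (⟨f.tgt, 0⟩ : FBondY i)) (β i.hN i.D i.hk (bI ⟨f.tgt, 0⟩)) ≤ 1 := by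
    rw [distB, dist_symm_geoBT]; exact hβ1 ⟨f.tgt, 0⟩
  linarith [distB_triangle i (β i.hN i.D i.hk (bI f)) (blkV1 i.hN i.D f) (β i.hN i.D i.hk (bI ⟨f.tgt, 0⟩)),
    distB_triangle i (blkV1 i.hN i.D f) (blkV1 i.hN i.D (⟨f.tgt, 0⟩ : FBondY i)) (β i.hN i.D i.hk (bI ⟨f.tgt, 0⟩))]

/-- **THE INCOMING BOND AT A SITE IS RE-BLOCKED AT DISTANCE ≤ 3 FROM THE SITE**: `d(bI⟨x, e₀⟩, bI⟨x − e_μ, μ⟩) ≤ 3` (pin `hβ1`).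
[cite: Balaban1984PropagatorsII, (2.45)–(2.46) p.231, (2.54) p.233; Balaban1985BackgroundPropagators, p.421 (the transposed stencil)] -/
theorem dist_bI_unshift_le_three (hβ1 : ∀ f : FBondY i, (geomT i.D).dist (β i.hN i.D i.hk (bI f)) (blkV1 i.hN i.D f) ≤ 1)
    (s : Site (PV d ℓ i.m i.K hd hL) 0) (μ : Fin (d + 1)) :
    (geo9K i).dist (bI ⟨s, 0⟩) (bI ⟨s.unshift μ, μ⟩) ≤ 3 := by
  have h := dist_bI_tgt_le_three i hβ1 ⟨s.unshift μ, μ⟩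
  have e : (⟨s.unshift μ, μ⟩ : FBondY i).tgt = s := shift_unshift s μ
  rw [e] at h
  rw [geo9K_dist_comm]; exact h

/-- **A ONE-LEVEL WINDOW AT DISTANCE ≤ 3**: two index bonds whose carrier blocks are at torus graph distance ≤ 3 have levels differing by at most one —
blocks two levels apart are `R·L·M_h ≥ 16` bonds apart ([4] (2.2) in walk form, p21 `levelGapT`). (F12 `lvl_window_of_distT_le_one` is the `≤ 1` case with one end
a torus block.) [cite: Balaban1984PropagatorsII, (2.2) p.224, (2.45)–(2.46) p.231] -/
theorem lvl_window_of_dist_le_three (c c' : IBondY i) (h : (geo9K i).dist c c' ≤ 3) :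
    lvl i.hN i.D i.hk c ≤ lvl i.hN i.D i.hk c' + 1 ∧ lvl i.hN i.D i.hk c' ≤ lvl i.hN i.D i.hk c + 1 := by
  set y := β i.hN i.D i.hk c with hydef
  set y' := β i.hN i.D i.hk c' with hy'def
  have hk1 : 1 ≤ i.k := le_trans one_le_two i.hk2
  have hyl : y.1.1 = lvl i.hN i.D i.hk c := beta_level i.hN i.D i.hk hk1 c
  have hy'l : y'.1.1 = lvl i.hN i.D i.hk c' := beta_level i.hN i.D i.hk hk1 c'
  have hdist : (((bondT i.D).dist y y' : ℕ) : ℝ) ≤ 3 := h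
  have hd3 : (bondT i.D).dist y y' ≤ 3 := by exact_mod_cast hdist
  have h8 : 8 ≤ i.Mh := i.hM8
  have hconn : (bondT i.D).Connected := connectedT (D := i.D) (by omega) (fun μ => by have := i.hP5 μ; omega)
  obtain ⟨p, hp⟩ := (hconn.preconnected y y').exists_walk_length_eq_dist
  have hgap : ∀ ⦃j : ℕ⦄ ⦃u v : ↥(B6Geom246MultiLevelBox.bset i.D.toDomains)⦄, u.1.1 < j → j < v.1.1 →
      ∀ q : (bondT i.D).Walk u v, i.R * ((ℓ + 1) * i.Mh) - 1 + 1 ≤ q.length := levelGapT i.D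
  have hR : 2 * (ℓ + 1) ^ 2 ≤ i.R := i.hR2
  have hR2 : 2 ≤ i.R := le_trans (Nat.le_mul_of_pos_right 2 (pow_pos (Nat.succ_pos ℓ) 2)) hR
  have hM8' : 8 ≤ (ℓ + 1) * i.Mh := le_trans h8 (Nat.le_mul_of_pos_left _ (Nat.succ_pos ℓ))
  have hRM : 2 * 8 ≤ i.R * ((ℓ + 1) * i.Mh) := Nat.mul_le_mul hR2 hM8'
  rw [← hyl, ← hy'l]
  constructor
  · by_contra hlt
    push Not at hlt
    have hq := hgap (j := y'.1.1 + 1) (u := y') (v := y) (by omega) (by omega) p.reverse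
    rw [SimpleGraph.Walk.length_reverse] at hq
    omega
  · by_contra hlt
    push Not at hlt
    have hq := hgap (j := y.1.1 + 1) (u := y) (v := y') (by omega) (by omega) p
    omega

/-- one level up on the scale: `lev c′ ≤ lev c + 1 ⟹ (Lʲη)(c′) ≤ L·(Lʲη)(c)` in `geo9K`. [cite: Balaban1984PropagatorsII, (2.1) p.224, bookkeeping] -/
theorem len_le_L_mul_len_of_lvl {c c' : IBondY i} (h : lvl i.hN i.D i.hk c' ≤ lvl i.hN i.D i.hk c + 1) :
    (geo9K i).len c' ≤ (geo9K i).L * (geo9K i).len c := by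
  show (((ℓ + 1 : ℕ) : ℝ)) ^ (lvl i.hN i.D i.hk c') * |i.cf|⁻¹ ≤ (((ℓ + 1 : ℕ) : ℝ)) * ((((ℓ + 1 : ℕ) : ℝ)) ^ (lvl i.hN i.D i.hk c) * |i.cf|⁻¹)
  have hL1 : (1 : ℝ) ≤ ((ℓ + 1 : ℕ) : ℝ) := by exact_mod_cast Nat.succ_le_succ (Nat.zero_le ℓ)
  have hη : (0 : ℝ) ≤ |i.cf|⁻¹ := inv_nonneg.mpr (abs_nonneg _)
  calc (((ℓ + 1 : ℕ) : ℝ)) ^ (lvl i.hN i.D i.hk c') * |i.cf|⁻¹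
      ≤ (((ℓ + 1 : ℕ) : ℝ)) ^ (lvl i.hN i.D i.hk c + 1) * |i.cf|⁻¹ := mul_le_mul_of_nonneg_right (pow_le_pow_right₀ hL1 h) hη
    _ = (((ℓ + 1 : ℕ) : ℝ)) * ((((ℓ + 1 : ℕ) : ℝ)) ^ (lvl i.hN i.D i.hk c) * |i.cf|⁻¹) := by rw [pow_succ]; ring

/-- `ξ′ ≤ L·ξ ⟹ ξ⁻³ ≤ L³·ξ′⁻³` (F12's `inv_pow_le_of_window` at `p = 3`, where `1 ≤ L` is not needed; restated to keep this file's imports light).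
[cite: Balaban1985BackgroundPropagators, p.396, bookkeeping] -/
theorem inv_cube_le_of_window {L ξ ξ' : ℝ} (hξ : 0 < ξ) (hξ' : 0 < ξ') (hw : ξ' ≤ L * ξ) : (ξ ^ 3)⁻¹ ≤ L ^ 3 * (ξ' ^ 3)⁻¹ := by
  have h1 : ξ' ^ 3 ≤ L ^ 3 * ξ ^ 3 :=
    calc ξ' ^ 3 ≤ (L * ξ) ^ 3 := pow_le_pow_left₀ hξ'.le hw 3
      _ = L ^ 3 * ξ ^ 3 := mul_pow L ξ 3
  rw [← div_eq_mul_inv, le_div_iff₀ (pow_pos hξ' 3), inv_mul_le_iff₀ (pow_pos hξ 3)]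
  linarith [mul_comm (ξ ^ 3) (L ^ 3)]

/-- ★ **`(Lʲη)⁻³` ACROSS A DISTANCE-≤-3 PAIR COSTS `L³`**: `((geo9K i).len c′³)⁻¹ ≤ L³·((geo9K i).len c³)⁻¹` whenever `d(c, c′) ≤ 3`.
[cite: Balaban1984PropagatorsII, (2.1)–(2.2) p.224; Balaban1985BackgroundPropagators, p.396, (3.36) (the power `(Lʲη)⁻³`)] -/
theorem inv_len_cube_le_of_dist_le_three {c c' : IBondY i} (h : (geo9K i).dist c c' ≤ 3) :
    ((geo9K i).len c' ^ 3)⁻¹ ≤ (geo9K i).L ^ 3 * ((geo9K i).len c ^ 3)⁻¹ :=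
  inv_cube_le_of_window (geo9K_len_pos i c') (geo9K_len_pos i c) (len_le_L_mul_len_of_lvl i (lvl_window_of_dist_le_three i c c' h).1)

end Geometry

/-! ## §3 The models `BcoKH ∕ BdcoKH` unfolded; the pointwise bounds under the letter -/

section Pointwise

variable {𝔸 : Type} [NormedRing 𝔸] [NormedAlgebra ℂ 𝔸] [CompleteSpace 𝔸] [FiniteDimensional ℝ 𝔸]
variable {κ : Type} [Fintype κ]
variable (i : KIdx d ℓ hd hL b₀ b₁) (b : Module.Basis κ ℝ 𝔸) (B : B9.Backgrounds) (cfg : B.Cfg → CfgY 𝔸 i)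

/-- ★ **THE MODEL `B(U₁)`, UNFOLDED**: `(B F)(f, ν, c, c′) = (cR39 b)⁻¹ · repr_c ((Δ(U₁)D_{U₁} w)(f))`, `w = Σ_a F(·, ν, a, c′)·b_a` the re-assembled slice.
[cite: Balaban1985BackgroundPropagators, (3.117) p.419, (3.42) p.397, dictionary] -/
theorem BcoKH_apply (U₁ : B.Cfg) (F : XSK κ i → ℝ) (q : XBK κ i) :
    BcoKH i b B cfg U₁ F q = (cR39 b)⁻¹ * b.repr (hessGradY i (cfg U₁) (assembleK b q.2.1 q.2.2.2 F) q.1) q.2.2.1 := by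
  simp only [BcoKH, LinearMap.smul_apply, Pi.smul_apply, smul_eq_mul, coordOpKH_apply, LinearMap.restrictScalars_apply]

/-- ★ **THE MODEL `B†(U₁)`, UNFOLDED**: `(B† A)(z, ν, c, c′) = (cR39 b)⁻¹ · repr_c ((D*_{U₁}Δ(U₁) W)(z))`, `W = Σ_a A(·, ν, a, c′)·b_a`.
[cite: Balaban1985BackgroundPropagators, (3.117) p.419, p.421, (3.42) p.397, dictionary] -/
theorem BdcoKH_apply (U₁ : B.Cfg) (A : XBK κ i → ℝ) (p : XSK κ i) :
    BdcoKH i b B cfg U₁ A p = (cR39 b)⁻¹ * b.repr (divHessY i (cfg U₁) (assembleK b p.2.1 p.2.2.2 A) p.1) p.2.2.1 := by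
  simp only [BdcoKH, LinearMap.smul_apply, Pi.smul_apply, smul_eq_mul, coordOpKH_apply, LinearMap.restrictScalars_apply]

/-- ★ **THE POINTWISE BOUND OF `B(U₁)` UNDER THE LETTER**:
`|(B F)(f, ν, c, c′)| ≤ (cR39 b)⁻¹·coordBound·k₃·‖J(f)‖·basisBound·(Σ_a|F(f₋, ν, a, c′)| + Σ_a|F(f₊, ν, a, c′)|)`.
[cite: Balaban1985BackgroundPropagators, (3.117) p.419, (3.42) p.397, dictionary] -/
theorem abs_BcoKH_apply_le {k₃ : ℝ} (hk₃ : 0 ≤ k₃) {U₁ : B.Cfg}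
    (hg : ∀ (Λ : SiteY i → 𝔸) (f : FBondY i),
      ‖hessGradY i (cfg U₁) Λ f‖ ≤ k₃ * ‖JY i (cfg U₁) f‖ * (‖Λ (boxEquiv i.hN f.src)‖ + ‖Λ (boxEquiv i.hN f.tgt)‖))
    (F : XSK κ i → ℝ) (q : XBK κ i) :
    |BcoKH i b B cfg U₁ F q| ≤ (cR39 b)⁻¹ * (coordBound39 b * (k₃ * ‖JY i (cfg U₁) q.1‖ *
      (basisBound39 b * ∑ a, |F (boxEquiv i.hN q.1.src, q.2.1, a, q.2.2.2)| +
        basisBound39 b * ∑ a, |F (boxEquiv i.hN q.1.tgt, q.2.1, a, q.2.2.2)|))) := by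
  rw [BcoKH_apply]
  have hc0 : 0 ≤ (cR39 b)⁻¹ := inv_nonneg.mpr (cR39_nonneg b)
  have hcb : 0 ≤ coordBound39 b := norm_nonneg _
  have hk : 0 ≤ k₃ * ‖JY i (cfg U₁) q.1‖ := mul_nonneg hk₃ (norm_nonneg _)
  have h1 := hg (assembleK b q.2.1 q.2.2.2 F) q.1
  have h2 : ‖hessGradY i (cfg U₁) (assembleK b q.2.1 q.2.2.2 F) q.1‖ ≤ k₃ * ‖JY i (cfg U₁) q.1‖ *
      (basisBound39 b * ∑ a, |F (boxEquiv i.hN q.1.src, q.2.1, a, q.2.2.2)| +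
        basisBound39 b * ∑ a, |F (boxEquiv i.hN q.1.tgt, q.2.1, a, q.2.2.2)|) :=
    h1.trans (mul_le_mul_of_nonneg_left (add_le_add (norm_sum_smul_basis_le b _) (norm_sum_smul_basis_le b _)) hk)
  rw [abs_mul, abs_of_nonneg hc0]
  exact mul_le_mul_of_nonneg_left ((abs_repr_le b _ _).trans (mul_le_mul_of_nonneg_left h2 hcb)) hc0

/-- ★ **THE POINTWISE BOUND OF `B†(U₁)` UNDER THE LETTER** (at the site charted from `x`):
`|(B† A)(x, ν, c, c′)| ≤ (cR39 b)⁻¹·coordBound·k₃·Σ_μ (‖J⟨x,μ⟩‖·basisBound·Σ_a|A(⟨x,μ⟩, ν, a, c′)| + ‖J⟨x−e_μ,μ⟩‖·basisBound·Σ_a|A(⟨x−e_μ,μ⟩, ν, a, c′)|)`.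
[cite: Balaban1985BackgroundPropagators, (3.117) p.419, p.421, (3.42) p.397, dictionary] -/
theorem abs_BdcoKH_apply_le {k₃ : ℝ} (hk₃ : 0 ≤ k₃) {U₁ : B.Cfg}
    (hdh : ∀ (A : FBondY i → 𝔸) (s : Site (PV d ℓ i.m i.K hd hL) 0), ‖divHessY i (cfg U₁) A (boxEquiv i.hN s)‖ ≤
      k₃ * ∑ μ : Fin (d + 1), (‖JY i (cfg U₁) ⟨s, μ⟩‖ * ‖A ⟨s, μ⟩‖ + ‖JY i (cfg U₁) ⟨s.unshift μ, μ⟩‖ * ‖A ⟨s.unshift μ, μ⟩‖))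
    (A : XBK κ i → ℝ) (s : Site (PV d ℓ i.m i.K hd hL) 0) (ν : Fin (d + 1)) (c c' : κ) :
    |BdcoKH i b B cfg U₁ A (boxEquiv i.hN s, ν, c, c')| ≤ (cR39 b)⁻¹ * (coordBound39 b * (k₃ *
      ∑ μ : Fin (d + 1), (‖JY i (cfg U₁) ⟨s, μ⟩‖ * (basisBound39 b * ∑ a, |A (⟨s, μ⟩, ν, a, c')|) +
        ‖JY i (cfg U₁) ⟨s.unshift μ, μ⟩‖ * (basisBound39 b * ∑ a, |A (⟨s.unshift μ, μ⟩, ν, a, c')|)))) := by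
  rw [BdcoKH_apply]
  have hc0 : 0 ≤ (cR39 b)⁻¹ := inv_nonneg.mpr (cR39_nonneg b)
  have hcb : 0 ≤ coordBound39 b := norm_nonneg _
  have h1 := hdh (assembleK b ν c' A) s
  have h2 : ‖divHessY i (cfg U₁) (assembleK b ν c' A) (boxEquiv i.hN s)‖ ≤ k₃ *
      ∑ μ : Fin (d + 1), (‖JY i (cfg U₁) ⟨s, μ⟩‖ * (basisBound39 b * ∑ a, |A (⟨s, μ⟩, ν, a, c')|) +
        ‖JY i (cfg U₁) ⟨s.unshift μ, μ⟩‖ * (basisBound39 b * ∑ a, |A (⟨s.unshift μ, μ⟩, ν, a, c')|)) := by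
    refine h1.trans (mul_le_mul_of_nonneg_left (Finset.sum_le_sum fun μ _ => add_le_add ?_ ?_) hk₃)
    · exact mul_le_mul_of_nonneg_left (norm_sum_smul_basis_le b _) (norm_nonneg _)
    · exact mul_le_mul_of_nonneg_left (norm_sum_smul_basis_le b _) (norm_nonneg _)
  rw [abs_mul, abs_of_nonneg hc0]
  exact mul_le_mul_of_nonneg_left ((abs_repr_le b _ _).trans (mul_le_mul_of_nonneg_left h2 hcb)) hc0

end Pointwise

/-! ## §4 The [4]-(2.51) majorants of `B(U₁)` and `B†(U₁)` between the certificate's carriers; the pair `CurrentMaj` -/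

section Majorant

variable {𝔸 : Type} [NormedRing 𝔸] [NormedAlgebra ℂ 𝔸] [CompleteSpace 𝔸] [FiniteDimensional ℝ 𝔸]
variable {κ : Type} [Fintype κ]
variable (i : KIdx d ℓ hd hL b₀ b₁) (b : Module.Basis κ ℝ 𝔸) (B : B9.Backgrounds) (cfg : B.Cfg → CfgY 𝔸 i)
variable {bI : FBondY i → IBondY i}

/-- the minimal constant of the pair: `2(d+1)·L³·k₃·C_J·e^{3δ}`. [cite: Balaban1985BackgroundPropagators, (3.117) p.419 with (3.36) p.396 («t_B = O(1)·Mα₀»), bookkeeping] -/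
theorem tB_nonneg {k₃ CJ δ : ℝ} (hk₃ : 0 ≤ k₃) (hCJ : 0 ≤ CJ) :
    0 ≤ 2 * ((d : ℝ) + 1) * (geo9K i).L ^ 3 * k₃ * CJ * Real.exp (3 * δ) := by
  have hL : 0 ≤ (geo9K i).L := le_trans zero_le_one (geo9K_one_le_L i)
  positivity

/-- ★★ **THE [4]-(2.51) MAJORANT OF `B(U₁) = Δ(U₁)∘D_{U₁}` AT THE PINS FROM THE LETTER**: from the clause `hg` at `cfg U₁`, a per-bond current size
`‖J(U₁)(f)‖ ≤ C_J·((geo9K i).len (bI f)³)⁻¹` and the pins `hβ1` (1-faithful `bI`) ∕ `hbI0` (direction-blind `bI`), the model `BcoKH … U₁` from the site carrier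
(block map `blkSK (sIK bI)`) to the bond carrier (block map `blkBK bI`) has the majorant `t_B·((geo9K i).len a³)⁻¹·e^{−δ d(a, a′)}` for every `δ ≥ 0` and every
`t_B ≥ 2(d+1)·L³·k₃·C_J·e^{3δ}` — the output at `f` reads the input only at `f₋ ∈ Δ(bI f)` and `f₊`, a block within distance 3.
[cite: Balaban1985BackgroundPropagators, (3.117) p.419, (3.36) p.396, p.422; Balaban1984PropagatorsII, (2.51) p.232, (2.45)–(2.46) p.231] -/
theorem hasMajorantHom_BcoKH_of_letter [Fintype (geo9K i).Site]
    (hβ1 : ∀ f : FBondY i, (geomT i.D).dist (β i.hN i.D i.hk (bI f)) (blkV1 i.hN i.D f) ≤ 1)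
    (hbI0 : ∀ f : FBondY i, bI f = bI ⟨f.src, 0⟩)
    {k₃ : ℝ} (hk₃ : 0 ≤ k₃) {U₁ : B.Cfg}
    (hg : ∀ (Λ : SiteY i → 𝔸) (f : FBondY i),
      ‖hessGradY i (cfg U₁) Λ f‖ ≤ k₃ * ‖JY i (cfg U₁) f‖ * (‖Λ (boxEquiv i.hN f.src)‖ + ‖Λ (boxEquiv i.hN f.tgt)‖))
    {CJ : ℝ} (hCJ : 0 ≤ CJ) (hJ : ∀ f : FBondY i, ‖JY i (cfg U₁) f‖ ≤ CJ * ((geo9K i).len (bI f) ^ 3)⁻¹)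
    {δ : ℝ} (hδ : 0 ≤ δ) {tB : ℝ} (htB : 2 * ((d : ℝ) + 1) * (geo9K i).L ^ 3 * k₃ * CJ * Real.exp (3 * δ) ≤ tB) (R₀ : ℝ) (H₀ : Prop) :
    HasMajorantHom (g := toB6 (geo9K i) R₀ H₀) (blkSK i (sIK i bI)) (blkBK i bI) (BcoKH i b B cfg U₁)
      (fun a a' => tB * ((geo9K i).len a ^ 3)⁻¹ * Real.exp (-(δ * (geo9K i).dist a a'))) := by
  intro y' F Bμ hμ q
  change IBondY i at y'
  change |BcoKH i b B cfg U₁ F q| ≤ tB * ((geo9K i).len (bI q.1) ^ 3)⁻¹ * Real.exp (-(δ * (geo9K i).dist (bI q.1) y')) * Bμ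
  -- the slices of the input: `≤ |κ|·Bμ` everywhere, `0` off the block of `y′`
  have hslice : ∀ z : SiteY i, ∑ a, |F (z, q.2.1, a, q.2.2.2)| ≤ (Fintype.card κ : ℝ) * Bμ := fun z => by
    calc ∑ a, |F (z, q.2.1, a, q.2.2.2)| ≤ ∑ _a : κ, Bμ := Finset.sum_le_sum fun a _ => by
          by_cases hz : sIK i bI z = y'
          · exact hμ.bound (z, q.2.1, a, q.2.2.2) hz
          · rw [hμ.off (z, q.2.1, a, q.2.2.2) hz, abs_zero]; exact hμ.nonneg
      _ = (Fintype.card κ : ℝ) * Bμ := by rw [Finset.sum_const, nsmul_eq_mul, Finset.card_univ]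
  have hslice0 : ∀ z : SiteY i, sIK i bI z ≠ y' → ∑ a, |F (z, q.2.1, a, q.2.2.2)| = 0 := fun z hz =>
    Finset.sum_eq_zero fun a _ => by rw [hμ.off (z, q.2.1, a, q.2.2.2) hz, abs_zero]
  -- the two input blocks
  have hb1 : sIK i bI (boxEquiv i.hN q.1.src) = bI q.1 := sIK_boxEquiv_src i hbI0 q.1
  have hb2 : sIK i bI (boxEquiv i.hN q.1.tgt) = bI ⟨q.1.tgt, 0⟩ := sIK_boxEquiv i q.1.tgt
  have hd2 : (geo9K i).dist (bI q.1) (bI ⟨q.1.tgt, 0⟩) ≤ 3 := dist_bI_tgt_le_three i hβ1 q.1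
  have hpt := abs_BcoKH_apply_le i b B cfg hk₃ hg F q
  have hc0 : 0 ≤ (cR39 b)⁻¹ := inv_nonneg.mpr (cR39_nonneg b)
  have hcb : 0 ≤ coordBound39 b := norm_nonneg _
  have hbb : 0 ≤ basisBound39 b := Finset.sum_nonneg fun _ _ => norm_nonneg _
  have hk : 0 ≤ k₃ * ‖JY i (cfg U₁) q.1‖ := mul_nonneg hk₃ (norm_nonneg _)
  have hlen3 : 0 ≤ ((geo9K i).len (bI q.1) ^ 3)⁻¹ := inv_nonneg.mpr (pow_nonneg (geo9K_len_pos i _).le 3)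
  have hK0 : 0 ≤ tB * ((geo9K i).len (bI q.1) ^ 3)⁻¹ * Real.exp (-(δ * (geo9K i).dist (bI q.1) y')) :=
    mul_nonneg (mul_nonneg ((tB_nonneg i hk₃ hCJ).trans htB) hlen3) (Real.exp_nonneg _)
  by_cases hnear : (geo9K i).dist (bI q.1) y' ≤ 3
  · -- both slices ≤ |κ|Bμ; the reading constant collapses; the current gives (Lʲη)⁻³; e^{3δ}e^{−δd} ≥ 1
    have hsum : basisBound39 b * ∑ a, |F (boxEquiv i.hN q.1.src, q.2.1, a, q.2.2.2)| +
        basisBound39 b * ∑ a, |F (boxEquiv i.hN q.1.tgt, q.2.1, a, q.2.2.2)| ≤ basisBound39 b * ((Fintype.card κ : ℝ) * (2 * Bμ)) := by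
      have e : basisBound39 b * ((Fintype.card κ : ℝ) * (2 * Bμ)) =
          basisBound39 b * ((Fintype.card κ : ℝ) * Bμ) + basisBound39 b * ((Fintype.card κ : ℝ) * Bμ) := by ring
      rw [e]
      exact add_le_add (mul_le_mul_of_nonneg_left (hslice _) hbb) (mul_le_mul_of_nonneg_left (hslice _) hbb)
    have h1 : |BcoKH i b B cfg U₁ F q| ≤ k₃ * ‖JY i (cfg U₁) q.1‖ * (2 * Bμ) := by
      refine hpt.trans ?_
      have e : (cR39 b)⁻¹ * (coordBound39 b * (k₃ * ‖JY i (cfg U₁) q.1‖ * (basisBound39 b * ((Fintype.card κ : ℝ) * (2 * Bμ))))) =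
          k₃ * ‖JY i (cfg U₁) q.1‖ * ((cR39 b)⁻¹ * (coordBound39 b * (basisBound39 b * ((Fintype.card κ : ℝ) * (2 * Bμ))))) := by ring
      refine (mul_le_mul_of_nonneg_left (mul_le_mul_of_nonneg_left (mul_le_mul_of_nonneg_left hsum hk) hcb) hc0).trans ?_
      rw [e]
      exact mul_le_mul_of_nonneg_left (reading_const_collapse b (by linarith [hμ.nonneg])) hk
    have h2 : k₃ * ‖JY i (cfg U₁) q.1‖ * (2 * Bμ) ≤ 2 * k₃ * CJ * ((geo9K i).len (bI q.1) ^ 3)⁻¹ * Bμ := by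
      have := mul_le_mul_of_nonneg_left (hJ q.1) hk₃
      nlinarith [hμ.nonneg, this]
    have hK1 : 2 * k₃ * CJ * ((geo9K i).len (bI q.1) ^ 3)⁻¹ ≤
        tB * ((geo9K i).len (bI q.1) ^ 3)⁻¹ * Real.exp (-(δ * (geo9K i).dist (bI q.1) y')) := by
      have hE : 1 ≤ Real.exp (3 * δ) * Real.exp (-(δ * (geo9K i).dist (bI q.1) y')) := by
        rw [← Real.exp_add]
        exact Real.one_le_exp (by nlinarith [mul_le_mul_of_nonneg_left hnear hδ])
      have hL3 : 1 ≤ (geo9K i).L ^ 3 := one_le_pow₀ (geo9K_one_le_L i)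
      have hd1 : (1 : ℝ) ≤ (d : ℝ) + 1 := by linarith [(Nat.cast_nonneg d : (0 : ℝ) ≤ d)]
      have hkC : 0 ≤ k₃ * CJ := mul_nonneg hk₃ hCJ
      calc 2 * k₃ * CJ * ((geo9K i).len (bI q.1) ^ 3)⁻¹
          = (2 * 1 * 1 * (k₃ * CJ) * 1) * ((geo9K i).len (bI q.1) ^ 3)⁻¹ := by ring
        _ ≤ (2 * ((d : ℝ) + 1) * (geo9K i).L ^ 3 * (k₃ * CJ) * (Real.exp (3 * δ) * Real.exp (-(δ * (geo9K i).dist (bI q.1) y')))) *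
              ((geo9K i).len (bI q.1) ^ 3)⁻¹ := by
            refine mul_le_mul_of_nonneg_right ?_ hlen3
            gcongr
        _ = (2 * ((d : ℝ) + 1) * (geo9K i).L ^ 3 * k₃ * CJ * Real.exp (3 * δ)) * ((geo9K i).len (bI q.1) ^ 3)⁻¹ *
              Real.exp (-(δ * (geo9K i).dist (bI q.1) y')) := by ring
        _ ≤ tB * ((geo9K i).len (bI q.1) ^ 3)⁻¹ * Real.exp (-(δ * (geo9K i).dist (bI q.1) y')) :=
            mul_le_mul_of_nonneg_right (mul_le_mul_of_nonneg_right htB hlen3) (Real.exp_nonneg _)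
    calc |BcoKH i b B cfg U₁ F q| ≤ k₃ * ‖JY i (cfg U₁) q.1‖ * (2 * Bμ) := h1
      _ ≤ 2 * k₃ * CJ * ((geo9K i).len (bI q.1) ^ 3)⁻¹ * Bμ := h2
      _ ≤ _ := mul_le_mul_of_nonneg_right hK1 hμ.nonneg
  · -- beyond distance 3 both slices vanish
    have hz1 : sIK i bI (boxEquiv i.hN q.1.src) ≠ y' := by
      rw [hb1]; intro h; apply hnear; rw [← h, geo9K_dist_self]; norm_num
    have hz2 : sIK i bI (boxEquiv i.hN q.1.tgt) ≠ y' := by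
      rw [hb2]; intro h; rw [h] at hd2; exact hnear hd2
    rw [hslice0 _ hz1, hslice0 _ hz2, mul_zero, add_zero, mul_zero, mul_zero, mul_zero] at hpt
    exact hpt.trans (mul_nonneg hK0 hμ.nonneg)

/-- ★★ **THE [4]-(2.51) MAJORANT OF `B†(U₁) = D*_{U₁}∘Δ(U₁)` AT THE PINS FROM THE LETTER**: the transposed model `BdcoKH … U₁` from the bond carrier
(`blkBK bI`) to the site carrier (`blkSK (sIK bI)`) has the majorant `t_B·((geo9K i).len a³)⁻¹·e^{−δ d(a, a′)}`, every `δ ≥ 0`, `t_B ≥ 2(d+1)·L³·k₃·C_J·e^{3δ}`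
— the output at `x` reads the `2(d+1)` bonds at `x`, re-blocked within distance 3 of `Δ(bI⟨x, e₀⟩)`, their `(Lʲη)⁻³` moved to the output block at the
price `L³` of the one-level window. [cite: Balaban1985BackgroundPropagators, (3.117) p.419, p.421, (3.36) p.396; Balaban1984PropagatorsII, (2.51) p.232, (2.2) p.224, (2.45)–(2.46) p.231] -/
theorem hasMajorantHom_BdcoKH_of_letter [Fintype (geo9K i).Site]
    (hβ1 : ∀ f : FBondY i, (geomT i.D).dist (β i.hN i.D i.hk (bI f)) (blkV1 i.hN i.D f) ≤ 1)
    (hbI0 : ∀ f : FBondY i, bI f = bI ⟨f.src, 0⟩)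
    {k₃ : ℝ} (hk₃ : 0 ≤ k₃) {U₁ : B.Cfg}
    (hdh : ∀ (A : FBondY i → 𝔸) (s : Site (PV d ℓ i.m i.K hd hL) 0), ‖divHessY i (cfg U₁) A (boxEquiv i.hN s)‖ ≤
      k₃ * ∑ μ : Fin (d + 1), (‖JY i (cfg U₁) ⟨s, μ⟩‖ * ‖A ⟨s, μ⟩‖ + ‖JY i (cfg U₁) ⟨s.unshift μ, μ⟩‖ * ‖A ⟨s.unshift μ, μ⟩‖))
    {CJ : ℝ} (hCJ : 0 ≤ CJ) (hJ : ∀ f : FBondY i, ‖JY i (cfg U₁) f‖ ≤ CJ * ((geo9K i).len (bI f) ^ 3)⁻¹)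
    {δ : ℝ} (hδ : 0 ≤ δ) {tB : ℝ} (htB : 2 * ((d : ℝ) + 1) * (geo9K i).L ^ 3 * k₃ * CJ * Real.exp (3 * δ) ≤ tB) (R₀ : ℝ) (H₀ : Prop) :
    HasMajorantHom (g := toB6 (geo9K i) R₀ H₀) (blkBK i bI) (blkSK i (sIK i bI)) (BdcoKH i b B cfg U₁)
      (fun a a' => tB * ((geo9K i).len a ^ 3)⁻¹ * Real.exp (-(δ * (geo9K i).dist a a'))) := by
  intro y' A Bμ hμ p
  change IBondY i at y'
  -- chart the output site from the torus
  obtain ⟨z, ν, c, c'⟩ := p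
  obtain ⟨s, rfl⟩ := (boxEquiv i.hN).surjective z
  change |BdcoKH i b B cfg U₁ A (boxEquiv i.hN s, ν, c, c')| ≤ tB * ((geo9K i).len (sIK i bI (boxEquiv i.hN s)) ^ 3)⁻¹ *
    Real.exp (-(δ * (geo9K i).dist (sIK i bI (boxEquiv i.hN s)) y')) * Bμ
  rw [sIK_boxEquiv]
  -- slices of the input: `≤ |κ|·Bμ` everywhere, `0` off the block of `y′`
  have hslice : ∀ f : FBondY i, ∑ a, |A (f, ν, a, c')| ≤ (Fintype.card κ : ℝ) * Bμ := fun f => by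
    calc ∑ a, |A (f, ν, a, c')| ≤ ∑ _a : κ, Bμ := Finset.sum_le_sum fun a _ => by
          by_cases hf : bI f = y'
          · exact hμ.bound (f, ν, a, c') hf
          · rw [hμ.off (f, ν, a, c') hf, abs_zero]; exact hμ.nonneg
      _ = (Fintype.card κ : ℝ) * Bμ := by rw [Finset.sum_const, nsmul_eq_mul, Finset.card_univ]
  have hslice0 : ∀ f : FBondY i, bI f ≠ y' → ∑ a, |A (f, ν, a, c')| = 0 := fun f hf =>
    Finset.sum_eq_zero fun a _ => by rw [hμ.off (f, ν, a, c') hf, abs_zero]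
  -- the 2(d+1) input bonds sit within distance 3 of the output block
  have hdo : ∀ μ : Fin (d + 1), (geo9K i).dist (bI ⟨s, 0⟩) (bI ⟨s, μ⟩) ≤ 3 := fun μ => by
    have e : bI ⟨s, μ⟩ = bI ⟨s, 0⟩ := hbI0 ⟨s, μ⟩
    rw [e, geo9K_dist_self]; norm_num
  have hdi : ∀ μ : Fin (d + 1), (geo9K i).dist (bI ⟨s, 0⟩) (bI ⟨s.unshift μ, μ⟩) ≤ 3 := fun μ => dist_bI_unshift_le_three i hβ1 s μ
  have hpt := abs_BdcoKH_apply_le i b B cfg hk₃ hdh A s ν c c'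
  have hc0 : 0 ≤ (cR39 b)⁻¹ := inv_nonneg.mpr (cR39_nonneg b)
  have hcb : 0 ≤ coordBound39 b := norm_nonneg _
  have hbb : 0 ≤ basisBound39 b := Finset.sum_nonneg fun _ _ => norm_nonneg _
  have hlen3 : 0 ≤ ((geo9K i).len (bI ⟨s, 0⟩) ^ 3)⁻¹ := inv_nonneg.mpr (pow_nonneg (geo9K_len_pos i _).le 3)
  have hK0 : 0 ≤ tB * ((geo9K i).len (bI ⟨s, 0⟩) ^ 3)⁻¹ * Real.exp (-(δ * (geo9K i).dist (bI ⟨s, 0⟩) y')) :=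
    mul_nonneg (mul_nonneg ((tB_nonneg i hk₃ hCJ).trans htB) hlen3) (Real.exp_nonneg _)
  -- the current at a bond within distance 3, moved to the output block
  have hJ3 : ∀ f : FBondY i, (geo9K i).dist (bI ⟨s, 0⟩) (bI f) ≤ 3 →
      ‖JY i (cfg U₁) f‖ ≤ CJ * ((geo9K i).L ^ 3 * ((geo9K i).len (bI ⟨s, 0⟩) ^ 3)⁻¹) := fun f hf =>
    (hJ f).trans (mul_le_mul_of_nonneg_left (inv_len_cube_le_of_dist_le_three i hf) hCJ)
  by_cases hnear : (geo9K i).dist (bI ⟨s, 0⟩) y' ≤ 3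
  · have hterm : ∀ f : FBondY i, (geo9K i).dist (bI ⟨s, 0⟩) (bI f) ≤ 3 →
        ‖JY i (cfg U₁) f‖ * (basisBound39 b * ∑ a, |A (f, ν, a, c')|) ≤
          CJ * ((geo9K i).L ^ 3 * ((geo9K i).len (bI ⟨s, 0⟩) ^ 3)⁻¹) * (basisBound39 b * ((Fintype.card κ : ℝ) * Bμ)) := fun f hf =>
      mul_le_mul (hJ3 f hf) (mul_le_mul_of_nonneg_left (hslice f) hbb) (mul_nonneg hbb (Finset.sum_nonneg fun _ _ => abs_nonneg _))
        (mul_nonneg hCJ (mul_nonneg (pow_nonneg (le_trans zero_le_one (geo9K_one_le_L i)) 3) hlen3))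
    have hsum : ∑ μ : Fin (d + 1), (‖JY i (cfg U₁) ⟨s, μ⟩‖ * (basisBound39 b * ∑ a, |A (⟨s, μ⟩, ν, a, c')|) +
        ‖JY i (cfg U₁) ⟨s.unshift μ, μ⟩‖ * (basisBound39 b * ∑ a, |A (⟨s.unshift μ, μ⟩, ν, a, c')|)) ≤
          2 * ((d : ℝ) + 1) * (CJ * ((geo9K i).L ^ 3 * ((geo9K i).len (bI ⟨s, 0⟩) ^ 3)⁻¹) * (basisBound39 b * ((Fintype.card κ : ℝ) * Bμ))) := by
      calc ∑ μ : Fin (d + 1), (‖JY i (cfg U₁) ⟨s, μ⟩‖ * (basisBound39 b * ∑ a, |A (⟨s, μ⟩, ν, a, c')|) +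
            ‖JY i (cfg U₁) ⟨s.unshift μ, μ⟩‖ * (basisBound39 b * ∑ a, |A (⟨s.unshift μ, μ⟩, ν, a, c')|))
          ≤ ∑ _μ : Fin (d + 1), 2 * (CJ * ((geo9K i).L ^ 3 * ((geo9K i).len (bI ⟨s, 0⟩) ^ 3)⁻¹) * (basisBound39 b * ((Fintype.card κ : ℝ) * Bμ))) :=
            Finset.sum_le_sum fun μ _ => by
              have h1 := hterm ⟨s, μ⟩ (hdo μ)
              have h2 := hterm ⟨s.unshift μ, μ⟩ (hdi μ)
              linarith
        _ = _ := by rw [Finset.sum_const, Finset.card_univ, Fintype.card_fin, nsmul_eq_mul]; push_cast; ring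
    have h1 : |BdcoKH i b B cfg U₁ A (boxEquiv i.hN s, ν, c, c')| ≤
        2 * ((d : ℝ) + 1) * (geo9K i).L ^ 3 * k₃ * CJ * ((geo9K i).len (bI ⟨s, 0⟩) ^ 3)⁻¹ * Bμ := by
      refine hpt.trans ?_
      refine (mul_le_mul_of_nonneg_left (mul_le_mul_of_nonneg_left (mul_le_mul_of_nonneg_left hsum hk₃) hcb) hc0).trans ?_
      have e : (cR39 b)⁻¹ * (coordBound39 b * (k₃ * (2 * ((d : ℝ) + 1) *
            (CJ * ((geo9K i).L ^ 3 * ((geo9K i).len (bI ⟨s, 0⟩) ^ 3)⁻¹) * (basisBound39 b * ((Fintype.card κ : ℝ) * Bμ)))))) =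
          2 * ((d : ℝ) + 1) * (geo9K i).L ^ 3 * k₃ * CJ * ((geo9K i).len (bI ⟨s, 0⟩) ^ 3)⁻¹ *
            ((cR39 b)⁻¹ * (coordBound39 b * (basisBound39 b * ((Fintype.card κ : ℝ) * Bμ)))) := by ring
      rw [e]
      refine mul_le_mul_of_nonneg_left (reading_const_collapse b hμ.nonneg) ?_
      have hL : 0 ≤ (geo9K i).L := le_trans zero_le_one (geo9K_one_le_L i)
      positivity
    have hK1 : 2 * ((d : ℝ) + 1) * (geo9K i).L ^ 3 * k₃ * CJ * ((geo9K i).len (bI ⟨s, 0⟩) ^ 3)⁻¹ ≤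
        tB * ((geo9K i).len (bI ⟨s, 0⟩) ^ 3)⁻¹ * Real.exp (-(δ * (geo9K i).dist (bI ⟨s, 0⟩) y')) := by
      have hE : 1 ≤ Real.exp (3 * δ) * Real.exp (-(δ * (geo9K i).dist (bI ⟨s, 0⟩) y')) := by
        rw [← Real.exp_add]
        exact Real.one_le_exp (by nlinarith [mul_le_mul_of_nonneg_left hnear hδ])
      have h0 : 0 ≤ 2 * ((d : ℝ) + 1) * (geo9K i).L ^ 3 * k₃ * CJ := by
        have hL : 0 ≤ (geo9K i).L := le_trans zero_le_one (geo9K_one_le_L i)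
        positivity
      calc 2 * ((d : ℝ) + 1) * (geo9K i).L ^ 3 * k₃ * CJ * ((geo9K i).len (bI ⟨s, 0⟩) ^ 3)⁻¹
          = (2 * ((d : ℝ) + 1) * (geo9K i).L ^ 3 * k₃ * CJ * 1) * ((geo9K i).len (bI ⟨s, 0⟩) ^ 3)⁻¹ := by ring
        _ ≤ (2 * ((d : ℝ) + 1) * (geo9K i).L ^ 3 * k₃ * CJ * (Real.exp (3 * δ) * Real.exp (-(δ * (geo9K i).dist (bI ⟨s, 0⟩) y')))) *
              ((geo9K i).len (bI ⟨s, 0⟩) ^ 3)⁻¹ := mul_le_mul_of_nonneg_right (mul_le_mul_of_nonneg_left hE h0) hlen3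
        _ = (2 * ((d : ℝ) + 1) * (geo9K i).L ^ 3 * k₃ * CJ * Real.exp (3 * δ)) * ((geo9K i).len (bI ⟨s, 0⟩) ^ 3)⁻¹ *
              Real.exp (-(δ * (geo9K i).dist (bI ⟨s, 0⟩) y')) := by ring
        _ ≤ _ := mul_le_mul_of_nonneg_right (mul_le_mul_of_nonneg_right htB hlen3) (Real.exp_nonneg _)
    exact h1.trans (mul_le_mul_of_nonneg_right hK1 hμ.nonneg)
  · -- beyond distance 3 every slice vanishes
    have hz1 : ∀ μ : Fin (d + 1), bI ⟨s, μ⟩ ≠ y' := fun μ h => hnear (h ▸ hdo μ)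
    have hz2 : ∀ μ : Fin (d + 1), bI ⟨s.unshift μ, μ⟩ ≠ y' := fun μ h => hnear (h ▸ hdi μ)
    have hsum0 : ∑ μ : Fin (d + 1), (‖JY i (cfg U₁) ⟨s, μ⟩‖ * (basisBound39 b * ∑ a, |A (⟨s, μ⟩, ν, a, c')|) +
        ‖JY i (cfg U₁) ⟨s.unshift μ, μ⟩‖ * (basisBound39 b * ∑ a, |A (⟨s.unshift μ, μ⟩, ν, a, c')|)) = 0 :=
      Finset.sum_eq_zero fun μ _ => by rw [hslice0 _ (hz1 μ), hslice0 _ (hz2 μ), mul_zero, mul_zero, mul_zero, add_zero]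
    rw [hsum0, mul_zero, mul_zero, mul_zero] at hpt
    exact hpt.trans (mul_nonneg hK0 hμ.nonneg)

/-- ★★ **THE PAIR IS `CurrentMaj`**: under the norm-local (3.117) letter at `cfg U₁`, a per-bond current size `C_J·(Lʲη)⁻³` at the pinned scale and the pins,
dag-n06-l's schema `CurrentMaj (blkSK (sIK bI)) (blkBK bI) (BcoKH … U₁) (BdcoKH … U₁) R₀ H₀ t_B δ` HOLDS for every `δ ≥ 0` and `t_B ≥ 2(d+1)·L³·k₃·C_J·e^{3δ}`.
[cite: Balaban1985BackgroundPropagators, (3.117) p.419 with (3.36) p.396, p.422; Balaban1984PropagatorsII, (2.51) p.232] -/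
theorem currentMaj_of_letter [Fintype (geo9K i).Site]
    (hβ1 : ∀ f : FBondY i, (geomT i.D).dist (β i.hN i.D i.hk (bI f)) (blkV1 i.hN i.D f) ≤ 1)
    (hbI0 : ∀ f : FBondY i, bI f = bI ⟨f.src, 0⟩)
    {k₃ : ℝ} (hk₃ : 0 ≤ k₃) {U₁ : B.Cfg}
    (hg : ∀ (Λ : SiteY i → 𝔸) (f : FBondY i),
      ‖hessGradY i (cfg U₁) Λ f‖ ≤ k₃ * ‖JY i (cfg U₁) f‖ * (‖Λ (boxEquiv i.hN f.src)‖ + ‖Λ (boxEquiv i.hN f.tgt)‖))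
    (hdh : ∀ (A : FBondY i → 𝔸) (s : Site (PV d ℓ i.m i.K hd hL) 0), ‖divHessY i (cfg U₁) A (boxEquiv i.hN s)‖ ≤
      k₃ * ∑ μ : Fin (d + 1), (‖JY i (cfg U₁) ⟨s, μ⟩‖ * ‖A ⟨s, μ⟩‖ + ‖JY i (cfg U₁) ⟨s.unshift μ, μ⟩‖ * ‖A ⟨s.unshift μ, μ⟩‖))
    {CJ : ℝ} (hCJ : 0 ≤ CJ) (hJ : ∀ f : FBondY i, ‖JY i (cfg U₁) f‖ ≤ CJ * ((geo9K i).len (bI f) ^ 3)⁻¹)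
    {δ : ℝ} (hδ : 0 ≤ δ) {tB : ℝ} (htB : 2 * ((d : ℝ) + 1) * (geo9K i).L ^ 3 * k₃ * CJ * Real.exp (3 * δ) ≤ tB) (R₀ : ℝ) (H₀ : Prop) :
    CurrentMaj (g := geo9K i) (blkSK i (sIK i bI)) (blkBK i bI) (BcoKH i b B cfg U₁) (BdcoKH i b B cfg U₁) R₀ H₀ tB δ :=
  ⟨hasMajorantHom_BcoKH_of_letter i b B cfg hβ1 hbI0 hk₃ hg hCJ hJ hδ htB R₀ H₀,
    hasMajorantHom_BdcoKH_of_letter i b B cfg hβ1 hbI0 hk₃ hdh hCJ hJ hδ htB R₀ H₀⟩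

end Majorant

end Literature.MathematicalPhysics.QuantumFieldTheory.Balaban1983to89.B9Eq3117CurrentMajFromLetter

end
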